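import Mathlib
import Summits.ValiantsHypothesis.ValiantsHypothesis.Theorems.NewtonUnitEquationsTwoProductsRankOneFourLawPlanar
import Summits.ValiantsHypothesis.ValiantsHypothesis.Theorems.TwoProducts.Negative.ClassCoverSharedAlphabet
import Summits.ValiantsHypothesis.ValiantsHypothesis.Theorems.TwoProducts.Negative.TwoLetterShapeEscapes
import HarnessLib

/-!
# `TwoProducts` (stmt-ValiantsHypothesis-5906), line `relation_ladder` — NEGATIVE lane: RANK TWO escapes EVERY rank-one clause
# (present and future) of the residual — two independent additive coincidences admit NO rank-one datum at all

Helper file of the Negative lane (val-neg-1 g4; `--supports stmt-ValiantsHypothesis-5906`; closes NO item).  Kernel form of the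
rank-≥-2 half of the first-inhabitant analysis of the residual (evidence #44 on the item, memo
`NOTE-neg1g4-5906-V20-inhabitants-R8-preaudit.md`; predecessors' #47/#48/#56).

* ABSTRACT CORE `no_rankOne_datum_of_two_coincidences`: if a letter family `A` has two additive coincidences `a₁ ~ b₁`, `a₂ ~ b₂`,
  each with DIFFERENT letter multisets, whose DISAGREEMENT sets are disjoint (at every letter at least one of the two pairs agrees),
  then `RankOneCoincidences A ρ⁺ ρ⁻` (tree, `…RankOneFourLawPlanar`) fails for EVERY datum `(ρ⁺, ρ⁻)`: a datum must agree wherever a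
  genuine coincidence agrees (`rankOne_agree_of_coincidence`), hence everywhere, hence `ρ⁺ = ρ⁻`, and then the first coincidence would be
  of permutation type.  No shape, support or coefficient hypothesis on the datum enters.
* THE RANK-TWO FAMILY: a shared alphabet `A l = E` containing two collinear pairs `β₁, α₁ = 2•β₁` and `β₂, α₂ = 2•β₂` on four distinct
  letters, two positions `i ≠ j`: the swaps `(α₁ | 0) ~ (β₁ | β₁)` and `(α₂ | 0) ~ (β₂ | β₂)` are such a pair of coincidences, so
  `no_rankOne_datum : ¬ RankOneCoincidences A ρ⁺ ρ⁻` for all `ρ⁺, ρ⁻` (`not_exists_rankOne_datum`).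
* CONSEQUENTLY the family satisfies every `¬`-clause of `ResidualLawV20` (`Cruxes/TwoProducts/Lines/relation_ladder.lean` v20) and
  escapes the typed R8 target: the five V18 clauses (R6, R6b, R6c, R7a, R6d) are ALREADY escaped by the single pair `(α₁, β₁)`
  (`TwoLetterEscape.not_fourTermRankOne` … `not_threeTermHomRankOne`, tree), and so is R7b's `ThreeTermGenRankOne`
  (`not_threeTermGenRankOne` below, ONE pair suffices: the datum disagrees at three letters); the two clauses that a single collinear
  pair does NOT escape — R7c's `TwoTermRankOne` (which the generic `α = 2β` family satisfies — on paper, memo §0 (1)) and R8's `OneSidedRankOne` (`k = 1` is R7c) — are escaped by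
  RANK TWO: `not_twoTermRankOne`, `not_oneSidedRankOne` (Cruxes files are not importable, so the clause BODIES are restated verbatim as
  the negated statements).  Any later clause of the form `∃ …, RankOneCoincidences A ρ⁺ ρ⁻` is escaped by the same one-liner.
* NON-VACUITY of the letter hypotheses: `example_no_rankOne_datum` — the alphabet `{(1,0),(2,0),(0,1),(0,2)} ⊂ ℕ²` on two positions.

READING (information for the line owner, not an objection): rank-one rungs, however many shapes they cover, leave the rank-≥-2 planted
families in the residual; with `ClassCoverBound.classCover_lower_bound` (HYP2 automatic) these sit at the HYP1 frontier `t₀(m)+0/1`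
(m = 6..10: t = 209, 81, 51, 39, 33).  Honest framing: `TwoProducts` (5906), the residual LAW and VP ≠ VNP are NOT proved here and are
not claimed. [folklore]
-/

namespace Summit.ValiantsHypothesis.Theorems.TwoProducts.Negative.RankTwoEscape

open Finset
open Summit.ValiantsHypothesis.ValiantsHypothesis.Theorems.NewtonUnitEquations.TwoProducts.FormalLogLinearisation (Expo)
open Summit.ValiantsHypothesis.ValiantsHypothesis.Theorems.NewtonUnitEquations.TwoProducts.PlanarCell (tuples)
open Summit.ValiantsHypothesis.ValiantsHypothesis.Theorems.NewtonUnitEquations.TwoProducts.PermutationType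
  (msetT RankOneCoincidences)
open Summit.ValiantsHypothesis.Theorems.TwoProducts.Negative.ClassCoverBound
open Summit.ValiantsHypothesis.Theorems.TwoProducts.Negative.TwoLetterEscape

variable {m : ℕ}

/-! ### Abstract core: a rank-one datum agrees wherever a genuine coincidence agrees -/

/-- Cancellation: from `P + k•ρp = Q + k•ρm` with `P ≠ Q` (so `k ≠ 0`) and `P e = Q e`, get `ρp e = ρm e`. [folklore] -/
theorem agree_of_shift_eq {P Q ρp ρm : Expo →₀ ℕ} {k : ℕ} (hne : P ≠ Q) {e : Expo} (he : P e = Q e)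
    (h : P + k • ρp = Q + k • ρm) : ρp e = ρm e := by
  have hk : k ≠ 0 := by
    rintro rfl
    simp only [zero_smul, add_zero] at h
    exact hne h
  have h1 := DFunLike.congr_fun h e
  simp only [Finsupp.add_apply, Finsupp.smul_apply, smul_eq_mul, he] at h1
  exact Nat.eq_of_mul_eq_mul_left (Nat.pos_of_ne_zero hk) (by omega)

/-- **A rank-one datum agrees wherever a genuine coincidence agrees.**  If `a ~ b` is an additive coincidence of `A` with
`msetT a ≠ msetT b`, then any `(ρp, ρm)` with `RankOneCoincidences A ρp ρm` has `ρp e = ρm e` at every letter `e` where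
`msetT a e = msetT b e`. [folklore] -/
theorem rankOne_agree_of_coincidence {A : Fin m → Finset Expo} {ρp ρm : Expo →₀ ℕ} (h : RankOneCoincidences A ρp ρm)
    {a b : Fin m → Expo} (ha : a ∈ tuples A) (hb : b ∈ tuples A) (hs : ∑ j, a j = ∑ j, b j)
    (hne : msetT a ≠ msetT b) {e : Expo} (he : msetT a e = msetT b e) : ρp e = ρm e := by
  obtain ⟨k, hk | hk⟩ := h a ha b hb hs
  · exact agree_of_shift_eq hne he hk
  · exact agree_of_shift_eq hne.symm he.symm hk

/-- **Abstract core: two coincidences with disjoint disagreement sets admit no rank-one datum.** [folklore] -/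
theorem no_rankOne_datum_of_two_coincidences {A : Fin m → Finset Expo} {a₁ b₁ a₂ b₂ : Fin m → Expo}
    (ha₁ : a₁ ∈ tuples A) (hb₁ : b₁ ∈ tuples A) (hs₁ : ∑ j, a₁ j = ∑ j, b₁ j) (hne₁ : msetT a₁ ≠ msetT b₁)
    (ha₂ : a₂ ∈ tuples A) (hb₂ : b₂ ∈ tuples A) (hs₂ : ∑ j, a₂ j = ∑ j, b₂ j) (hne₂ : msetT a₂ ≠ msetT b₂)
    (hdis : ∀ e, msetT a₁ e = msetT b₁ e ∨ msetT a₂ e = msetT b₂ e) (ρp ρm : Expo →₀ ℕ) :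
    ¬ RankOneCoincidences A ρp ρm := by
  intro h
  have heq : ρp = ρm := Finsupp.ext fun e => (hdis e).elim
    (fun he => rankOne_agree_of_coincidence h ha₁ hb₁ hs₁ hne₁ he)
    (fun he => rankOne_agree_of_coincidence h ha₂ hb₂ hs₂ hne₂ he)
  subst heq
  obtain ⟨k, hk | hk⟩ := h a₁ ha₁ b₁ hb₁ hs₁
  · exact hne₁ (add_right_cancel hk)
  · exact hne₁ (add_right_cancel hk).symm

/-! ### One collinear pair already escapes R7b's three-letter clause (complement to `TwoLetterShapeEscapes`) -/

section OnePair

variable {E : Finset Expo} {A : Fin m → Finset Expo} (hA : ∀ l, A l = E) {α β : Expo} (hα : α ∈ E) (hβ : β ∈ E) (hβ0 : β ≠ 0)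
  (hαβ : α = 2 • β) {i j : Fin m} (hij : i ≠ j)
include hA hα hβ hβ0 hαβ hij

/-- The two-letter family `α = 2β` is NOT `ThreeTermGenRankOne` (R7b's hypothesis `pα' = qβ' + rγ'`, all `p, q, r ≥ 1`; body of the
v20 skeleton's def, verbatim): the datum disagrees at the three distinct letters `α', β', γ'`
(`TwoLetterEscape.not_rankOne_of_three_disagreements`).  So R7b, like R6…R7a, does not remove the family; R7c does. [folklore] -/
theorem not_threeTermGenRankOne :
    ¬ ∃ (α β γ : Expo) (p q r : ℕ), 1 ≤ p ∧ 1 ≤ q ∧ 1 ≤ r ∧ α ≠ β ∧ α ≠ γ ∧ β ≠ γ ∧ p • α = q • β + r • γ ∧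
      RankOneCoincidences A (Finsupp.single β q + Finsupp.single γ r) (Finsupp.single α p) := by
  rintro ⟨a, b, c, p, q, r, hp, hq, hr, hab, hac, hbc, -, hR⟩
  have hq0 : q ≠ 0 := by omega
  have hr0 : r ≠ 0 := by omega
  refine not_rankOne_of_three_disagreements hA hα hβ hβ0 hαβ hij hab hac hbc ?_ ?_ ?_ hR
  · simp [Ne.symm hab, Ne.symm hac]; omega
  · simp [hab, Ne.symm hbc, hq0]
  · simp [hac, hbc, hr0]

end OnePair

/-! ### The rank-two family: a shared alphabet with two collinear pairs `α₁ = 2β₁`, `α₂ = 2β₂` on four distinct letters -/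

/-- `2 • ·` is injective on `Expo`. [folklore] -/
theorem eq_of_two_nsmul_eq {β₁ β₂ : Expo} (h : 2 • β₁ = 2 • β₂) : β₁ = β₂ := by
  ext s
  have := DFunLike.congr_fun h s
  simp only [Finsupp.smul_apply, smul_eq_mul] at this
  omega

section TwoPairs

variable {E : Finset Expo} {A : Fin m → Finset Expo} (hA : ∀ l, A l = E) {α₁ β₁ α₂ β₂ : Expo}
  (hα₁ : α₁ ∈ E) (hβ₁ : β₁ ∈ E) (hα₂ : α₂ ∈ E) (hβ₂ : β₂ ∈ E) (hβ₁0 : β₁ ≠ 0) (hβ₂0 : β₂ ≠ 0)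
  (h₁ : α₁ = 2 • β₁) (h₂ : α₂ = 2 • β₂) (hβ : β₁ ≠ β₂) (hα₁β₂ : α₁ ≠ β₂) (hβ₁α₂ : β₁ ≠ α₂)
  {i j : Fin m} (hij : i ≠ j)
include hA hα₁ hβ₁ hα₂ hβ₂ hβ₁0 hβ₂0 h₁ h₂ hβ hα₁β₂ hβ₁α₂ hij

/-- **No rank-one datum fits the rank-two family.** [folklore] -/
theorem no_rankOne_datum (ρp ρm : Expo →₀ ℕ) : ¬ RankOneCoincidences A ρp ρm := by
  have hα₁0 : α₁ ≠ 0 := h₁ ▸ two_nsmul_ne_zero hβ₁0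
  have hα₂0 : α₂ ≠ 0 := h₂ ▸ two_nsmul_ne_zero hβ₂0
  have hα₁β₁ : α₁ ≠ β₁ := h₁ ▸ two_nsmul_ne_self hβ₁0
  have hα₂β₂ : α₂ ≠ β₂ := h₂ ▸ two_nsmul_ne_self hβ₂0
  have hα : α₁ ≠ α₂ := fun h => hβ (eq_of_two_nsmul_eq (h₁ ▸ h₂ ▸ h))
  -- the two swap coincidences `(α_k at i, 0 at j) ~ (β_k at i, β_k at j)`
  have ha₁ := swap_mem_tuples hA hij (Finset.mem_insert_of_mem hα₁) (Finset.mem_insert_self (0 : Expo) E)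
  have hb₁ := swap_mem_tuples hA hij (Finset.mem_insert_of_mem hβ₁) (Finset.mem_insert_of_mem hβ₁)
  have ha₂ := swap_mem_tuples hA hij (Finset.mem_insert_of_mem hα₂) (Finset.mem_insert_self (0 : Expo) E)
  have hb₂ := swap_mem_tuples hA hij (Finset.mem_insert_of_mem hβ₂) (Finset.mem_insert_of_mem hβ₂)
  have hs₁ : ∑ l, (Pi.single i α₁ + Pi.single j (0 : Expo) : Fin m → Expo) l =
      ∑ l, (Pi.single i β₁ + Pi.single j β₁ : Fin m → Expo) l := by
    rw [sum_swap, sum_swap, add_zero, h₁, two_nsmul]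
  have hs₂ : ∑ l, (Pi.single i α₂ + Pi.single j (0 : Expo) : Fin m → Expo) l =
      ∑ l, (Pi.single i β₂ + Pi.single j β₂ : Fin m → Expo) l := by
    rw [sum_swap, sum_swap, add_zero, h₂, two_nsmul]
  have hPa₁ : msetT (Pi.single i α₁ + Pi.single j (0 : Expo) : Fin m → Expo) = Finsupp.single α₁ 1 := by
    rw [msetT_swap hij, if_neg hα₁0, if_pos rfl, add_zero]
  have hPb₁ : msetT (Pi.single i β₁ + Pi.single j β₁ : Fin m → Expo) = Finsupp.single β₁ 1 + Finsupp.single β₁ 1 := by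
    rw [msetT_swap hij, if_neg hβ₁0]
  have hPa₂ : msetT (Pi.single i α₂ + Pi.single j (0 : Expo) : Fin m → Expo) = Finsupp.single α₂ 1 := by
    rw [msetT_swap hij, if_neg hα₂0, if_pos rfl, add_zero]
  have hPb₂ : msetT (Pi.single i β₂ + Pi.single j β₂ : Fin m → Expo) = Finsupp.single β₂ 1 + Finsupp.single β₂ 1 := by
    rw [msetT_swap hij, if_neg hβ₂0]
  have hne₁ : msetT (Pi.single i α₁ + Pi.single j (0 : Expo) : Fin m → Expo) ≠
      msetT (Pi.single i β₁ + Pi.single j β₁ : Fin m → Expo) := by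
    rw [hPa₁, hPb₁]
    intro h
    have := DFunLike.congr_fun h α₁
    simp [Ne.symm hα₁β₁] at this
  have hne₂ : msetT (Pi.single i α₂ + Pi.single j (0 : Expo) : Fin m → Expo) ≠
      msetT (Pi.single i β₂ + Pi.single j β₂ : Fin m → Expo) := by
    rw [hPa₂, hPb₂]
    intro h
    have := DFunLike.congr_fun h α₂
    simp [Ne.symm hα₂β₂] at this
  refine no_rankOne_datum_of_two_coincidences ha₁ hb₁ hs₁ hne₁ ha₂ hb₂ hs₂ hne₂ (fun e => ?_) ρp ρm
  rw [hPa₁, hPb₁, hPa₂, hPb₂]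
  by_cases he₁ : e = α₁
  · subst he₁
    right
    simp [hα, hα₁β₂]
  by_cases he₂ : e = β₁
  · subst he₂
    right
    simp [hβ₁α₂, hβ]
  left
  simp [Ne.symm he₁, Ne.symm he₂]

/-- No rank-one datum exists for the rank-two family (∃-form). [folklore] -/
theorem not_exists_rankOne_datum : ¬ ∃ ρp ρm : Expo →₀ ℕ, RankOneCoincidences A ρp ρm :=
  fun ⟨ρp, ρm, h⟩ => no_rankOne_datum hA hα₁ hβ₁ hα₂ hβ₂ hβ₁0 hβ₂0 h₁ h₂ hβ hα₁β₂ hβ₁α₂ hij ρp ρm h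

/-! ### The two clauses a single collinear pair does not escape: R7c's `TwoTermRankOne` and R8's `OneSidedRankOne` (bodies verbatim) -/

/-- The family is NOT `TwoTermRankOne` (R7c, two-letter torsion `pα = qβ`; body of the v20 def, verbatim) — although each of its
two planted relations `α_k = 2β_k` IS of that shape: rank two is what escapes. [folklore] -/
theorem not_twoTermRankOne :
    ¬ ∃ (α β : Expo) (p q : ℕ), 1 ≤ p ∧ 1 ≤ q ∧ α ≠ β ∧ p • α = q • β ∧
      RankOneCoincidences A (Finsupp.single β q) (Finsupp.single α p) :=
  fun ⟨_, _, _, _, _, _, _, _, hR⟩ => no_rankOne_datum hA hα₁ hβ₁ hα₂ hβ₂ hβ₁0 hβ₂0 h₁ h₂ hβ hα₁β₂ hβ₁α₂ hij _ _ hR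

/-- The family is NOT `OneSidedRankOne` (the typed R8 target `Lines/relation_ladder_sketch_R8.lean`, one-sided `p·α = Σ q_i β_i`,
any number `k ≥ 1` of plus-letters; body verbatim). [folklore] -/
theorem not_oneSidedRankOne :
    ¬ ∃ (α : Expo) (p k : ℕ) (β : Fin k → Expo) (q : Fin k → ℕ), 1 ≤ p ∧ 1 ≤ k ∧ (∀ i, 1 ≤ q i) ∧ Function.Injective β ∧
      (∀ i, β i ≠ α) ∧ p • α = ∑ i, q i • β i ∧
      RankOneCoincidences A (∑ i, Finsupp.single (β i) (q i)) (Finsupp.single α p) :=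
  fun ⟨_, _, _, _, _, _, _, _, _, _, _, hR⟩ => no_rankOne_datum hA hα₁ hβ₁ hα₂ hβ₂ hβ₁0 hβ₂0 h₁ h₂ hβ hα₁β₂ hβ₁α₂ hij _ _ hR

end TwoPairs

/-! ### Non-vacuity of the letter hypotheses: the alphabet `{(1,0), (2,0), (0,1), (0,2)}` on two positions -/

/-- The four-letter rank-two alphabet `{(1,0), (2,0), (0,1), (0,2)} ⊂ ℕ²`. [folklore] -/
theorem example_no_rankOne_datum (ρp ρm : Expo →₀ ℕ) :
    ¬ RankOneCoincidences
      (fun _ : Fin 2 => ({Finsupp.single 0 2, Finsupp.single 0 1, Finsupp.single 1 2, Finsupp.single 1 1} : Finset Expo)) ρp ρm := by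
  have h2 : ∀ s : Fin 2, (Finsupp.single s 2 : Expo) = 2 • Finsupp.single s 1 := fun s => by
    rw [Finsupp.smul_single]; rfl
  refine no_rankOne_datum (E := {Finsupp.single 0 2, Finsupp.single 0 1, Finsupp.single 1 2, Finsupp.single 1 1})
    (fun _ => rfl) (α₁ := Finsupp.single 0 2) (β₁ := Finsupp.single 0 1) (α₂ := Finsupp.single 1 2)
    (β₂ := Finsupp.single 1 1) (by simp) (by simp) (by simp) (by simp) (Finsupp.single_ne_zero.mpr one_ne_zero)
    (Finsupp.single_ne_zero.mpr one_ne_zero) (h2 0) (h2 1) ?_ ?_ ?_ (i := 0) (j := 1) (by decide) ρp ρm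
  · simp [Finsupp.single_eq_single_iff]
  · simp [Finsupp.single_eq_single_iff]
  · simp [Finsupp.single_eq_single_iff]

end Summit.ValiantsHypothesis.Theorems.TwoProducts.Negative.RankTwoEscape
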